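import Summits.AtomisticToContinuum.HydrodynamicLimit.Theorems.AntiMazurCoboundariesKineticWindowGronwallQuadraticMoment
import Summits.AtomisticToContinuum.HydrodynamicLimit.Theorems.OneFlightGossipEngineKineticCurrentsWindowLDUniformFibreExpMoment
import Literature.MathematicalPhysics.KineticTheory.HardSphereWindowPressureStatic
import HarnessLib

/-!
# Window exponential moment of `λ Σᵢ (1 + ‖vᵢ‖²)` under a local Gibbs law
# (stub `stub_windowEnergyMoment`, line `rare-band-ladder-dock` v7, crux `KineticWindowGronwall`,
# stmt-AtomisticToContinuum-9282)

Crux `Summit.AtomisticToContinuum.HydrodynamicLimit.Theses.AntiMazurCoboundaries.KineticWindowGronwall`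
(`= KineticFluxLdDecay → RelEntropyVanishing`), skeleton line `rare-band-ladder-dock` (v7), registered helper stub
`stub_windowEnergyMoment : WindowEnergyMoment` of the lead's family glue `stub_familyGlue`: every SMALL quadratic
remainder `η (1 + ‖v‖²)` of an observable comparison along a continuous family of profiles is paid by energy
conservation. The statements `TFlow`, `WindowEnergyMoment` are re-declared verbatim from the registered skeleton
`Cruxes/KineticWindowGronwall/Lines/rare_band_ladder_dock.lean` (§1, §1c).

STATEMENT. For a temperature ceiling `θM > 0` and a drift bound `U ≥ 0` there are `λ₀ > 0`, `C > 0` such that for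
all continuous data `(a, θ₀, u₀)` with `a, θ₀ > 0`, `θ₀ ≤ θM`, `‖u₀‖ ≤ U`, all `0 < σ ≤ 1/2`, `N`, flows `Φ`,
`0 ≤ λ ≤ λ₀` and windows `w > 0`:
`∫⁻ exp(Σᵢ w⁻¹ ∫₀ʷ λ (1 + ‖vᵢ(r)‖²) dr) dG_N(a, u₀, θ₀) ≤ exp(C λ (N + 1))`.
Here `λ₀ = 1/(8 θM)` and `C = 1 + 2U² + 12 θM`.

PROOF. (1) On a GOOD datum `z` each `r ↦ λ(1 + ‖vᵢ(r)‖²)` is interval integrable (continuous one-body observable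
along a good orbit, `HardSphereFlow.intervalIntegrable_comp_flow_of_continuous`), so the sum and the time integral
commute, and `Σᵢ ‖vᵢ(r)‖² = Σᵢ ‖vᵢ(0)‖²` by energy conservation
(`KineticWindowGronwallQuadraticMoment.sum_norm_sq_flow_eq`): the window functional equals the STATIC one
`λ Σᵢ (1 + ‖vᵢ‖²)` (`windowSum_one_add_sq_norm_eq`). (2) The local Gibbs law is carried by the good set
(`KineticWindowGronwallQuadraticMoment.ae_mem_good_localGibbsLaw`), so the two exponential moments agree
(`lintegral_congr_ae`). (3) `exp(λ Σᵢ (1 + ‖vᵢ‖²)) = Πᵢ g(zᵢ)` with the one-body factor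
`g(x, v) = exp(λ(1 + ‖v‖²))`, and the static fibre factorisation
`KineticCurrentsWindowLDUniformSketch.stub_fibreExpMoment` gives `≤ K^{N+1}` as soon as every fibre integral
`∫ g(x, v) M_{1, θ₀ x, u₀ x}(v) dv` is `≤ K`. (4) One site (`lintegral_exp_mul_one_add_sq_norm_gaussMeasure_le`):
under `N(u, θ id)` write `v = u + √θ w`, `w` standard Gaussian; `‖u + x‖² ≤ 2‖u‖² + 2‖x‖²` gives
`exp(λ(1 + ‖v‖²)) ≤ exp(λ(1 + 2U²)) · exp(2λ ‖√θ w‖²)`, and `∫ exp(2λ‖y‖²) N(0, θ id)(dy) = (1 − 4λθ)^{-3/2}`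
(`KineticWindowGronwallQuadraticMoment.lintegral_exp_mul_sq_norm_gaussMeasure`); finally
`(1 − x)^{-3/2} ≤ exp(3x)` for `0 ≤ x ≤ 1/2` (`log(1 − x) ≥ 1 − (1 − x)⁻¹ ≥ −2x`), `x = 4λθ ≤ 4λθM ≤ 1/2`, so
`K = exp((1 + 2U² + 12θM) λ)` and `K^{N+1} = exp(C λ (N+1))`.

Folklore (Gaussian moment generating function of `‖v‖²`; Spohn 1991, Part I §2.3 for the local equilibrium states).
No Theses declaration is concluded; no named fact is used.
-/

noncomputable section

open MeasureTheory
open scoped ENNReal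
open Literature.Analysis.FluidPDE Literature.MathematicalPhysics.KineticTheory

namespace Summit.AtomisticToContinuum.HydrodynamicLimit.Theorems.KineticWindowGronwallWindowEnergyMoment

/-! ### The statements (verbatim from the line skeleton `rare_band_ladder_dock`, §1 and §1c) -/

/-- The hard-sphere flow of `N+1` spheres at reduced density `σ` on `𝕋³`. -/
abbrev TFlow (σ : ℝ) (N : ℕ) : Type :=
  HardSphereFlow (Torus.geometry (Fin 3)) (hsDiameter σ N) (N + 1)

/-- **Helper stub `WindowEnergyMoment` (v7; energy conservation + fibre Gaussians): the window exponential moment of the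
quadratic one-body weight `λ(1 + ‖v‖²)` under a local Gibbs law.** For a temperature ceiling `θM > 0` and a drift bound `U ≥ 0`
there are `λ₀ > 0` and `C > 0` such that for every continuous datum `(a, θ₀, u₀)` with `a, θ₀ > 0`, `θ₀ ≤ θM`, `‖u₀‖ ≤ U`, every
`0 < σ ≤ 1/2`, `N`, flow `Φ`, `0 ≤ λ ≤ λ₀` and window `w > 0`:
`∫ exp(Σᵢ w⁻¹∫₀ʷ λ(1 + ‖vᵢ(r)‖²) dr) dλ^N ≤ e^{Cλ(N+1)}`. Proof plan: on good orbits the window functional equals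
`λ(N+1) + 2λ E(z)` (interval integrability of continuous one-body observables along good orbits, energy conservation
`IsHardSphereTrajectory.configEnergy_eq_holds`, cf. `KineticWindowGronwallQuadraticMoment.lintegral_exp_window_quadratic_eq`); the law is
carried by the good set (`ae_mem_good_localGibbsLaw`); statically `∫ Πᵢ e^{λ‖vᵢ‖²} dλ^N ≤ (sup_x ∫ e^{λ‖v‖²} N(u₀(x), θ₀(x)) dv)^{N+1}`
(fibrewise factorisation over the velocity Maxwellians, `StaticFreezing` / `FibreExpMoment` pattern) and
`∫ e^{λ‖v‖²} dN(u, θ) = (1 − 2λθ)^{-3/2} e^{λ‖u‖²/(1−2λθ)} ≤ e^{(6θM + 2U²)λ}` for `λ ≤ 1/(4θM)`. -/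
def WindowEnergyMoment : Prop :=
  ∀ (θM U : ℝ), 0 < θM → 0 ≤ U → ∃ lam₀ : ℝ, 0 < lam₀ ∧ ∃ C : ℝ, 0 < C ∧
    ∀ (a θ₀ : T3 → ℝ) (u₀ : T3 → V3), Continuous a → Continuous θ₀ → Continuous u₀ →
    (∀ x, 0 < a x) → (∀ x, 0 < θ₀ x) → (∀ x, θ₀ x ≤ θM) → (∀ x, ‖u₀ x‖ ≤ U) →
    ∀ σ : ℝ, 0 < σ → σ ≤ 1 / 2 → ∀ (N : ℕ) (Φ : TFlow σ N) (lam : ℝ), 0 ≤ lam → lam ≤ lam₀ →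
    ∀ w : ℝ, 0 < w →
      ∫⁻ z, ENNReal.ofReal (Real.exp (∑ i : Fin (N + 1),
          w⁻¹ * ∫ r in (0 : ℝ)..w, lam * (1 + ‖(Φ.flow r z i).2‖ ^ 2))) ∂(localGibbsLaw σ a u₀ θ₀ N Φ) ≤
        ENNReal.ofReal (Real.exp (C * lam * ((N : ℝ) + 1)))

/-! ### (1) Dynamics: the window functional is static on good orbits -/

section Flow

variable {σ : ℝ} {N : ℕ} (Φ : TFlow σ N)

/-- **The window functional of `λ(1 + ‖v‖²)` is frozen on good orbits** (`w ≠ 0`):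
`Σᵢ w⁻¹ ∫₀ʷ λ(1 + ‖vᵢ(r)‖²) dr = λ Σᵢ (1 + ‖vᵢ(0)‖²)` — each summand is interval
integrable along the good orbit (`HardSphereFlow.intervalIntegrable_comp_flow_of_continuous`), the sum commutes with
the time integral, and the total kinetic energy is conserved (`KineticWindowGronwallQuadraticMoment.sum_norm_sq_flow_eq`).
[folklore] -/
theorem windowSum_one_add_sq_norm_eq {z : Config (N + 1) (Fin 3) T3} (hz : z ∈ Φ.good) (lam : ℝ) {w : ℝ}
    (hw : w ≠ 0) :
    ∑ i, w⁻¹ * ∫ r in (0 : ℝ)..w, lam * (1 + ‖(Φ.flow r z i).2‖ ^ 2) =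
      lam * ∑ i, (1 + ‖(z i).2‖ ^ 2) := by
  have hint : ∀ i, IntervalIntegrable (fun r => lam * (1 + ‖(Φ.flow r z i).2‖ ^ 2)) volume 0 w := fun i =>
    Φ.intervalIntegrable_comp_flow_of_continuous hz
      (F := fun y : Config (N + 1) (Fin 3) T3 => lam * (1 + ‖(y i).2‖ ^ 2)) (by fun_prop) 0 w
  have hE : ∀ r, ∑ i, lam * (1 + ‖(Φ.flow r z i).2‖ ^ 2) = lam * ∑ i, (1 + ‖(z i).2‖ ^ 2) := by
    intro r
    rw [← Finset.mul_sum, Finset.sum_add_distrib, Finset.sum_add_distrib,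
      KineticWindowGronwallQuadraticMoment.sum_norm_sq_flow_eq Φ hz r]
  rw [← Finset.mul_sum, ← intervalIntegral.integral_finsetSum fun i _ => hint i]
  simp_rw [hE]
  rw [intervalIntegral.integral_const, sub_zero, smul_eq_mul, ← mul_assoc, inv_mul_cancel₀ hw, one_mul]

end Flow

/-! ### (4) One site: the quadratic exponential moment of a shifted Gaussian -/

/-- **`(1 − x)^{-3/2} ≤ exp(3x)` for `0 ≤ x ≤ 1/2`**: `log(1 − x) ≥ 1 − (1 − x)⁻¹ ≥ −2x`
(`Real.one_sub_inv_le_log_of_pos`, `(1 − x)(1 + 2x) ≥ 1`). [folklore] -/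
theorem one_sub_rpow_neg_three_halves_le_exp {x : ℝ} (hx0 : 0 ≤ x) (hx : x ≤ 1 / 2) :
    (1 - x) ^ (-(3 / 2 : ℝ)) ≤ Real.exp (3 * x) := by
  have hpos : 0 < 1 - x := by linarith
  rw [Real.rpow_def_of_pos hpos]
  refine Real.exp_le_exp.2 ?_
  have hlog : 1 - (1 - x)⁻¹ ≤ Real.log (1 - x) := Real.one_sub_inv_le_log_of_pos hpos
  have hinv : (1 - x)⁻¹ ≤ 1 + 2 * x := by
    rw [inv_le_iff_one_le_mul₀' hpos]
    nlinarith
  nlinarith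

/-- **One-site bound.** For `0 < θ ≤ θM`, `‖u‖ ≤ U`, `0 ≤ λ ≤ 1/(8θM)`:
`∫⁻ exp(λ(1 + ‖v‖²)) N(u, θ id)(dv) ≤ exp((1 + 2U² + 12θM) λ)` — change of variables `v = u + √θ w`
(`gaussMeasure u θ` is the image of the standard Gaussian), `‖u + x‖² ≤ 2‖u‖² + 2‖x‖²`, the closed form
`∫⁻ exp(2λ‖y‖²) N(0, θ id)(dy) = (1 − 4λθ)^{-3/2}`
(`KineticWindowGronwallQuadraticMoment.lintegral_exp_mul_sq_norm_gaussMeasure`) and `(1 − x)^{-3/2} ≤ exp(3x)` on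
`[0, 1/2]`. [folklore] -/
theorem lintegral_exp_mul_one_add_sq_norm_gaussMeasure_le {θ θM U lam : ℝ} (hθ : 0 < θ) (hθM : θ ≤ θM)
    {u : V3} (hu : ‖u‖ ≤ U) (hlam : 0 ≤ lam) (hlamM : lam ≤ 1 / (8 * θM)) :
    ∫⁻ v, ENNReal.ofReal (Real.exp (lam * (1 + ‖v‖ ^ 2))) ∂(gaussMeasure u θ) ≤
      ENNReal.ofReal (Real.exp ((1 + 2 * U ^ 2 + 12 * θM) * lam)) := by
  have hθMpos : 0 < θM := hθ.trans_le hθM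
  have hm1 : Measurable fun v : V3 => ENNReal.ofReal (Real.exp (lam * (1 + ‖v‖ ^ 2))) :=
    (Real.continuous_exp.comp (by fun_prop)).measurable.ennreal_ofReal
  have hm2 : Measurable fun v : V3 => ENNReal.ofReal (Real.exp (2 * lam * ‖v‖ ^ 2)) :=
    KineticWindowGronwallQuadraticMoment.measurable_ofReal_exp_mul_sq_norm _
  -- the Gaussian parameter `x = 4λθ ≤ 4λθM ≤ 1/2`
  have hlamθM : lam * θM ≤ 1 / 8 := by
    calc lam * θM ≤ 1 / (8 * θM) * θM := mul_le_mul_of_nonneg_right hlamM hθMpos.le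
      _ = 1 / 8 := by field_simp
  have hlamθ : lam * θ ≤ lam * θM := mul_le_mul_of_nonneg_left hθM hlam
  have h4 : 2 * lam * θ < 1 / 2 := by nlinarith
  have hU2 : ‖u‖ ^ 2 ≤ U ^ 2 := pow_le_pow_left₀ (norm_nonneg _) hu 2
  calc ∫⁻ v, ENNReal.ofReal (Real.exp (lam * (1 + ‖v‖ ^ 2))) ∂(gaussMeasure u θ)
      = ∫⁻ w, ENNReal.ofReal (Real.exp (lam * (1 + ‖u + Real.sqrt θ • w‖ ^ 2)))
          ∂(ProbabilityTheory.stdGaussian V3) := by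
        rw [gaussMeasure, lintegral_map hm1 (measurable_gaussShift u θ)]
    _ ≤ ∫⁻ w, ENNReal.ofReal (Real.exp (lam * (1 + 2 * U ^ 2))) *
          ENNReal.ofReal (Real.exp (2 * lam * ‖(0 : V3) + Real.sqrt θ • w‖ ^ 2))
          ∂(ProbabilityTheory.stdGaussian V3) := by
        refine lintegral_mono fun w => ?_
        rw [← ENNReal.ofReal_mul (Real.exp_pos _).le, ← Real.exp_add, zero_add]
        refine ENNReal.ofReal_le_ofReal (Real.exp_le_exp.2 ?_)
        have hsq : ‖u + Real.sqrt θ • w‖ ^ 2 ≤ 2 * ‖u‖ ^ 2 + 2 * ‖Real.sqrt θ • w‖ ^ 2 := by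
          have h1 : ‖u + Real.sqrt θ • w‖ ^ 2 ≤ (‖u‖ + ‖Real.sqrt θ • w‖) ^ 2 :=
            pow_le_pow_left₀ (norm_nonneg _) (norm_add_le _ _) 2
          nlinarith [sq_nonneg (‖u‖ - ‖Real.sqrt θ • w‖)]
        have h2 : lam * (1 + ‖u + Real.sqrt θ • w‖ ^ 2) ≤
            lam * (1 + 2 * U ^ 2 + 2 * ‖Real.sqrt θ • w‖ ^ 2) :=
          mul_le_mul_of_nonneg_left (by linarith) hlam
        linarith
    _ = ENNReal.ofReal (Real.exp (lam * (1 + 2 * U ^ 2))) *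
          ∫⁻ y, ENNReal.ofReal (Real.exp (2 * lam * ‖y‖ ^ 2)) ∂(gaussMeasure (0 : V3) θ) := by
        rw [lintegral_const_mul' _ _ ENNReal.ofReal_ne_top, gaussMeasure,
          lintegral_map hm2 (measurable_gaussShift (0 : V3) θ)]
    _ = ENNReal.ofReal (Real.exp (lam * (1 + 2 * U ^ 2))) *
          ENNReal.ofReal ((1 - 2 * (2 * lam) * θ) ^ (-(3 / 2 : ℝ))) := by
        rw [KineticWindowGronwallQuadraticMoment.lintegral_exp_mul_sq_norm_gaussMeasure hθ h4]
    _ ≤ ENNReal.ofReal (Real.exp (lam * (1 + 2 * U ^ 2))) * ENNReal.ofReal (Real.exp (12 * θM * lam)) := by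
        gcongr
        have hx0 : 0 ≤ 4 * lam * θ := by positivity
        have hx : 4 * lam * θ ≤ 1 / 2 := by nlinarith
        calc (1 - 2 * (2 * lam) * θ) ^ (-(3 / 2 : ℝ)) = (1 - 4 * lam * θ) ^ (-(3 / 2 : ℝ)) := by ring_nf
          _ ≤ Real.exp (3 * (4 * lam * θ)) := one_sub_rpow_neg_three_halves_le_exp hx0 hx
          _ ≤ Real.exp (12 * θM * lam) := Real.exp_le_exp.2 (by nlinarith)
    _ = ENNReal.ofReal (Real.exp ((1 + 2 * U ^ 2 + 12 * θM) * lam)) := by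
        rw [← ENNReal.ofReal_mul (Real.exp_pos _).le, ← Real.exp_add]
        ring_nf

/-- The one-site bound in the fibre currency of `stub_fibreExpMoment`:
`∫⁻ exp(λ(1 + ‖v‖²)) M_{1, θ, u}(v) dv ≤ exp((1 + 2U² + 12θM) λ)` (`M_{1,u,θ} dv = N(u, θ id)`,
`withDensity_localMaxwellian_eq_gaussMeasure`). [folklore] -/
theorem lintegral_exp_mul_one_add_sq_norm_localMaxwellian_le {θ θM U lam : ℝ} (hθ : 0 < θ) (hθM : θ ≤ θM)
    {u : V3} (hu : ‖u‖ ≤ U) (hlam : 0 ≤ lam) (hlamM : lam ≤ 1 / (8 * θM)) :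
    ∫⁻ v, ENNReal.ofReal (Real.exp (lam * (1 + ‖v‖ ^ 2))) * ENNReal.ofReal (localMaxwellian 1 θ u v) ≤
      ENNReal.ofReal (Real.exp ((1 + 2 * U ^ 2 + 12 * θM) * lam)) := by
  have hm1 : Measurable fun v : V3 => ENNReal.ofReal (Real.exp (lam * (1 + ‖v‖ ^ 2))) :=
    (Real.continuous_exp.comp (by fun_prop)).measurable.ennreal_ofReal
  have hM : Measurable fun v : V3 => ENNReal.ofReal (localMaxwellian 1 θ u v) :=
    (continuous_localMaxwellian 1 θ u).measurable.ennreal_ofReal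
  calc ∫⁻ v, ENNReal.ofReal (Real.exp (lam * (1 + ‖v‖ ^ 2))) * ENNReal.ofReal (localMaxwellian 1 θ u v)
      = ∫⁻ v, ((fun v : V3 => ENNReal.ofReal (localMaxwellian 1 θ u v)) *
          fun v : V3 => ENNReal.ofReal (Real.exp (lam * (1 + ‖v‖ ^ 2)))) v :=
        lintegral_congr fun v => mul_comm _ _
    _ = ∫⁻ v, ENNReal.ofReal (Real.exp (lam * (1 + ‖v‖ ^ 2))) ∂(gaussMeasure u θ) := by
        rw [← withDensity_localMaxwellian_eq_gaussMeasure hθ u, lintegral_withDensity_eq_lintegral_mul _ hM hm1]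
    _ ≤ _ := lintegral_exp_mul_one_add_sq_norm_gaussMeasure_le hθ hθM hu hlam hlamM

/-! ### (2)–(3) Assembly: the registered stub -/

/-- **`stub_windowEnergyMoment`: the registered statement `WindowEnergyMoment` holds**, with `λ₀ = 1/(8θM)` and
`C = 1 + 2U² + 12θM`: window functional = static functional on the conull good set (energy conservation), fibrewise
Gaussian factorisation (`KineticCurrentsWindowLDUniformSketch.stub_fibreExpMoment`), one-site bound. [folklore] -/
theorem stub_windowEnergyMoment : WindowEnergyMoment := by
  intro θM U hθM hU
  refine ⟨1 / (8 * θM), by positivity, 1 + 2 * U ^ 2 + 12 * θM, by positivity, ?_⟩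
  intro a θ₀ u₀ ha hθ hu ha0 hθ0 hθM' huU σ hσ hσ2 N Φ lam hlam hlam0 w hw
  -- the one-body factor and the one-site constant
  set g : T3 × V3 → ℝ≥0∞ := fun y => ENNReal.ofReal (Real.exp (lam * (1 + ‖y.2‖ ^ 2))) with hg
  have hgm : Measurable g := (Real.continuous_exp.comp (by fun_prop)).measurable.ennreal_ofReal
  set K : ℝ≥0∞ := ENNReal.ofReal (Real.exp ((1 + 2 * U ^ 2 + 12 * θM) * lam)) with hK
  have hfib : ∀ x : T3, ∫⁻ v, g (x, v) * ENNReal.ofReal (localMaxwellian 1 (θ₀ x) (u₀ x) v) ≤ K :=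
    fun x => lintegral_exp_mul_one_add_sq_norm_localMaxwellian_le (hθ0 x) (hθM' x) (huU x) hlam hlam0
  calc ∫⁻ z, ENNReal.ofReal (Real.exp (∑ i : Fin (N + 1),
          w⁻¹ * ∫ r in (0 : ℝ)..w, lam * (1 + ‖(Φ.flow r z i).2‖ ^ 2))) ∂(localGibbsLaw σ a u₀ θ₀ N Φ)
      = ∫⁻ z, ∏ i, g (z i) ∂(localGibbsLaw σ a u₀ θ₀ N Φ) := by
        refine lintegral_congr_ae ?_
        filter_upwards [KineticWindowGronwallQuadraticMoment.ae_mem_good_localGibbsLaw σ a u₀ θ₀ N Φ] with z hz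
        rw [windowSum_one_add_sq_norm_eq Φ hz lam hw.ne', Finset.mul_sum, Real.exp_sum,
          ENNReal.ofReal_prod_of_nonneg fun i _ => (Real.exp_pos _).le]
    _ ≤ K ^ (N + 1) := by
        rw [localGibbsLaw_eq]
        exact KineticCurrentsWindowLDUniformSketch.stub_fibreExpMoment a θ₀ u₀ ha hθ hu ha0 hθ0 σ hσ hσ2 N g
          hgm K hfib
    _ = ENNReal.ofReal (Real.exp ((1 + 2 * U ^ 2 + 12 * θM) * lam * ((N : ℝ) + 1))) := by
        rw [hK, ← ENNReal.ofReal_pow (Real.exp_pos _).le, ← Real.exp_nat_mul]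
        push_cast
        ring_nf

end Summit.AtomisticToContinuum.HydrodynamicLimit.Theorems.KineticWindowGronwallWindowEnergyMoment

end
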